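import Summits.ValiantsHypothesis.ValiantsHypothesis.Theorems.FifoMatchingNNDivisionHardPencilCollapseFaces
import Summits.ValiantsHypothesis.ValiantsHypothesis.Theorems.FifoMatchingNNDivisionHardLowDimRate
import Summits.ValiantsHypothesis.ValiantsHypothesis.Theorems.FifoMatchingNNDivisionHardLocatedRowsColumnCoupled
import Summits.ValiantsHypothesis.ValiantsHypothesis.Theorems.FifoMatchingNNDivisionHardLocatedRowsTogetherFaceWeight

/-!
# PENCIL COLLAPSE (part 2/2: §4–§7) — PORT (val-port-3 g3; desk #444) of `Cruxes/NNDivisionHard/PencilCollapse41.lean` @74b940273780 (19dd3ecc7ffcf7b3;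
author val-idea-41 g5; critic val-idea-crit-9 g3 V#120a/V#121a; stmt-ValiantsHypothesis-21181): §4 `hasEFOfSize_face`, §5 block projection `π`, §6 ★
`law_of_corVirtualHardN_of_pencil`, §7 `boundedExactLaw_iff` / `singletonTiltedLaw_iff` / `exactPencilLaw_iff_singletonTiltedLaw`.  Part 1's `section Face` context
re-opened verbatim; §0 restatements replaced by the landed `LocatedRows.flat_add'`/`flat_smul'`/`LowDim.exists_fin_range_eq` (gate `dedup.landed`); docstrings added
for `lint.docstring`; nothing else edited; full docstring + port notes in `…PencilCollapseFaces.lean`.  Helper (`--supports` 21181); ALL CREDIT val-idea-41 g5.  HONEST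
LABEL: REFORMULATION; closes NO item; `(boundedExact B).Law`, `(singletonTilted B).Law`, `ExactPencilLaw`, `CorVirtualHardN`, 21181 OPEN (only EQUIVALENT); VP ≠ VNP NOT proved.
-/

set_option autoImplicit false
-- the mandated summit-side namespace repeats a component by design (single-problem summit)
set_option linter.dupNamespace false

noncomputable section

open Matrix Finset
open scoped Pointwise

namespace Summit.ValiantsHypothesis.ValiantsHypothesis.Theorems.FifoMatching.PencilCollapse

open Literature.Barriers.PneNP (HasEFOfSize hasEFOfSize_of_complete_nonneg_factorization
  convexHull_inter_dotProduct_eq_of_valid)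
open Literature.Combinatorics.Optimization.FixedSizePsdRank (Cube bvec flat vecOuter corPolytope bvec_zero_or_one)
open Summit.ValiantsHypothesis.ValiantsHypothesis.Theorems.FifoMatching.XcDivision (udInd udPt udRow udMat ud_data)
open Summit.ValiantsHypothesis.ValiantsHypothesis.Theorems.FifoMatching.LocatedRows
  (T CorVirtualHardN RowFamily exactTilted ExactPencilLaw hCOR le_hCOR exists_eq_hCOR flat_le_hCOR unflat flat_unflat
    corVirtualHardN_of_law corVirtualHardN_of_exactPencilLaw)
open Summit.ValiantsHypothesis.ValiantsHypothesis.Theorems.FifoMatching.ExactIsVirtual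
  (hCORv le_hCORv exists_eq_hCORv le_hCORv_of_mem hCOR_eq_hCORv hCORv_smul_le vecOuter_bvec_eq_udPt
    law_of_corVirtualHardN exactTilted_sharp exactPencilLaw_iff_corVirtualHardN)

section Face
variable {k : ℕ}
variable {K : ℕ}

/-! ## §4 Yannakakis' converse on the face pair -/

/-- ★★ **THE FACE PAIR HAS A SMALL EF.**  If the located slack of `COR(k+1) + Q` against a family with an infinitesimal exact pencil at `{0}`
factors nonnegatively through slots `σ` (a BLIND factorisation), then `xc(G₀ + F_Q) ≤ |σ|`: the pencil is complete for the face pair relative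
to `x₀₀ = 1 + M₀` (§3), the hyperplane is appended as two zero-slack rows, and `hasEFOfSize_of_complete_nonneg_factorization` applies to the
located columns. -/
theorem hasEFOfSize_face (F : RowFamily) (hP : Pencil F (k + 1) 0) (q : Fin (K + 1) → (Fin ((k + 1) * (k + 1)) → ℝ))
    (m : F.A (k + 1) → ℝ) (hmax : ∀ a, ∃ j, F.ρ (k + 1) a ⬝ᵥ q j = m a) {σ : Type} [Fintype σ]
    (U : F.A (k + 1) → σ → ℝ) (V : Finset (Fin (k + 1)) × Fin (K + 1) → σ → ℝ)
    (hU : ∀ a i, 0 ≤ U a i) (hV : ∀ p i, 0 ≤ V p i)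
    (hfac : ∀ a b j, (F.β (k + 1) a + m a) - F.ρ (k + 1) a ⬝ᵥ (udPt b + q j) = ∑ i, U a i * V (b, j) i) :
    HasEFOfSize (convexHull ℝ (Set.range (faceVert q))) (Fintype.card σ) := by
  classical
  refine hasEFOfSize_of_complete_nonneg_factorization (A := F.A (k + 1) ⊕ Bool) (faceVert q)
    (Sum.elim (F.ρ (k + 1)) (fun s => if s then udRow {0} else -udRow {0}))
    (Sum.elim (fun a => F.β (k + 1) a + m a) (fun s => if s then 1 + M₀ q else -(1 + M₀ q)))
    ?_ (Sum.elim U (fun _ _ => 0)) (fun p => V (lift p.1, (p.2 : Fin (K + 1)))) ?_ (fun p i => hV _ i) ?_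
  · intro x hx
    have h1 := hx (Sum.inr true)
    have h2 := hx (Sum.inr false)
    simp only [Sum.elim_inr] at h1 h2
    simp at h1 h2
    refine pencil_complete F hP q m hmax x (by linarith) fun a => ?_
    exact hx (Sum.inl a)
  · rintro (a | s) i
    · exact hU a i
    · simp
  · rintro (a | s) ⟨b', j⟩
    · exact hfac a (lift b') (j : Fin (K + 1))
    · have hq : udRow {0} ⬝ᵥ q (j : Fin (K + 1)) = M₀ q := mem_top.1 j.2
      have hb : udRow {0} ⬝ᵥ udPt (lift b') = 1 := by
        rw [udRow_singleton_dotProduct_udPt, if_pos (zero_mem_lift b')]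
      cases s <;> (simp [faceVert, dotProduct_add, neg_dotProduct, hq, hb]; try ring)

/-! ## §5 Transport to `COR(k) + Q'` by the block projection -/

/-- block coordinates `(i', j') ↦ (succ i', succ j')`. -/
def emb (p : Fin (k * k)) : Fin ((k + 1) * (k + 1)) :=
  finProdFinEquiv (Fin.succ (finProdFinEquiv.symm p).1, Fin.succ (finProdFinEquiv.symm p).2)

/-- the block projection `π x = x ∘ emb : ℝ^{(k+1)²} → ℝ^{k²}`. -/
def π : (Fin ((k + 1) * (k + 1)) → ℝ) →ₗ[ℝ] (Fin (k * k) → ℝ) := LinearMap.funLeft ℝ ℝ emb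

/-- `π x p = x (emb p)`. -/
theorem π_apply (x : Fin ((k + 1) * (k + 1)) → ℝ) (p : Fin (k * k)) : π x p = x (emb p) := rfl

/-- ★ the face vertex `x_{lift b'}` projects to the vertex `x_{b'}` of `COR(k)`. -/
theorem π_udPt_lift (b' : Finset (Fin k)) : π (udPt (lift b')) = udPt b' := by
  funext p
  rw [π_apply]
  simp only [udPt, vecOuter, emb, Equiv.symm_apply_apply, udInd, bvec, succ_mem_lift]

/-- `π` sends the face vertex `x_{lift b'} + q_j` to `udPt b' + π q_j`. -/
theorem π_faceVert (q : Fin (K + 1) → (Fin ((k + 1) * (k + 1)) → ℝ)) (p : Finset (Fin k) × (top q)) :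
    π (faceVert q p) = udPt p.1 + π (q (p.2 : Fin (K + 1))) := by
  simp only [faceVert, map_add, π_udPt_lift]

/-- `COR(k)` is the hull of the clique vertices indexed by subsets. -/
theorem corPolytope_eq_convexHull_udPt : corPolytope k = convexHull ℝ (Set.range (udPt : Finset (Fin k) → _)) := by
  unfold corPolytope
  congr 1
  ext y
  constructor
  · rintro ⟨a, rfl⟩
    exact ⟨Finset.univ.filter fun i => a i = true, (vecOuter_bvec_eq_udPt a).symm⟩
  · rintro ⟨b, rfl⟩
    exact ⟨fun i => decide (i ∈ b), rfl⟩

/-- ★ the block projection of the face pair is `COR(k) + conv(projected top generators)`. -/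
theorem π_image_face (q : Fin (K + 1) → (Fin ((k + 1) * (k + 1)) → ℝ)) :
    π '' convexHull ℝ (Set.range (faceVert q)) =
      corPolytope k + convexHull ℝ (Set.range fun j : top q => π (q (j : Fin (K + 1)))) := by
  rw [LinearMap.image_convexHull, ← Set.range_comp]
  have hr : Set.range (π ∘ faceVert q) =
      Set.range (udPt : Finset (Fin k) → _) + Set.range (fun j : top q => π (q (j : Fin (K + 1)))) := by
    ext y
    simp only [Set.mem_range, Set.mem_add, Function.comp_apply, π_faceVert]
    constructor
    · rintro ⟨⟨b', j⟩, rfl⟩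
      exact ⟨_, ⟨b', rfl⟩, _, ⟨j, rfl⟩, rfl⟩
    · rintro ⟨_, ⟨b', rfl⟩, _, ⟨j, rfl⟩, rfl⟩
      exact ⟨⟨b', j⟩, rfl⟩
  rw [hr, convexHull_add, corPolytope_eq_convexHull_udPt]

/-- ★ the projected top face of the passenger keeps the passenger's budget: `xc(π F_Q) ≤ xc(Q)` (a face, then a linear image). -/
theorem hasEFOfSize_topFace (q : Fin (K + 1) → (Fin ((k + 1) * (k + 1)) → ℝ)) {r : ℕ}
    (hQ : HasEFOfSize (convexHull ℝ (Set.range q)) r) :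
    HasEFOfSize (convexHull ℝ (Set.range fun j : top q => π (q (j : Fin (K + 1))))) r := by
  classical
  have hval : ∀ s ∈ (Finset.univ.image q), udRow {0} ⬝ᵥ s ≤ M₀ q := by
    intro s hs
    obtain ⟨j, -, rfl⟩ := Finset.mem_image.1 hs
    exact θ_le_M₀ q j
  have hface := convexHull_inter_dotProduct_eq_of_valid (Finset.univ.image q) (udRow {0}) (M₀ q) hval
  have h1 : HasEFOfSize (convexHull ℝ (Set.range q) ∩ {y | udRow {0} ⬝ᵥ y = M₀ q}) r := hQ.inter_eq _ _
  have hrange : Set.range q = ((Finset.univ.image q : Finset (Fin ((k + 1) * (k + 1)) → ℝ)) : Set _) := by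
    simp [Finset.coe_image]
  rw [hrange, hface] at h1
  have h2 := h1.image_linearMap π
  rw [LinearMap.image_convexHull] at h2
  have hset : (π : (Fin ((k + 1) * (k + 1)) → ℝ) →ₗ[ℝ] (Fin (k * k) → ℝ)) ''
      (((Finset.univ.image q).filter fun s => udRow {0} ⬝ᵥ s = M₀ q : Finset _) : Set _) =
      Set.range (fun j : top q => π (q (j : Fin (K + 1)))) := by
    ext y
    constructor
    · rintro ⟨s, hs, rfl⟩
      rw [Finset.mem_coe, Finset.mem_filter] at hs
      obtain ⟨hs1, hs2⟩ := hs
      obtain ⟨j, -, rfl⟩ := Finset.mem_image.1 hs1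
      exact ⟨⟨j, mem_top.2 hs2⟩, rfl⟩
    · rintro ⟨j, rfl⟩
      refine ⟨q (j : Fin (K + 1)), ?_, rfl⟩
      rw [Finset.mem_coe, Finset.mem_filter]
      exact ⟨Finset.mem_image.2 ⟨(j : Fin (K + 1)), Finset.mem_univ _, rfl⟩, mem_top.1 j.2⟩
  rw [hset] at h2
  exact h2

/-- POINTWISE (species) form: at order `k + 1`, a factorisation of the located slack of `COR(k+1) + Q` through slots `σ` that is BLIND to a
family with an infinitesimal exact pencil at `{0}` yields `HasEFOfSize (COR(k) + Q') |σ|` for the projected top face `Q'` of `Q`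
(whose own budget is at most that of `Q`, `hasEFOfSize_topFace`). -/
theorem hasEFOfSize_corFace_of_pencil_blind (F : RowFamily) (hP : Pencil F (k + 1) 0)
    (q : Fin (K + 1) → (Fin ((k + 1) * (k + 1)) → ℝ))
    (m : F.A (k + 1) → ℝ) (hmax : ∀ a, ∃ j, F.ρ (k + 1) a ⬝ᵥ q j = m a) {σ : Type} [Fintype σ]
    (U : F.A (k + 1) → σ → ℝ) (V : Finset (Fin (k + 1)) × Fin (K + 1) → σ → ℝ)
    (hU : ∀ a i, 0 ≤ U a i) (hV : ∀ p i, 0 ≤ V p i)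
    (hfac : ∀ a b j, (F.β (k + 1) a + m a) - F.ρ (k + 1) a ⬝ᵥ (udPt b + q j) = ∑ i, U a i * V (b, j) i) :
    HasEFOfSize (corPolytope k + convexHull ℝ (Set.range fun j : top q => π (q (j : Fin (K + 1))))) (Fintype.card σ) := by
  have h := (hasEFOfSize_face F hP q m hmax U V hU hV hfac).image_linearMap π
  rwa [π_image_face] at h

end Face

/-! ## §6 The pencil collapse theorem -/

/-- budget bookkeeping across the order shift: `T c (k+1) < T (c+1) k` once `k ≥ 2`. -/
theorem T_succ_lt_T_succ {c k : ℕ} (hk : 2 ≤ k) : T c (k + 1) < T (c + 1) k := by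
  unfold T
  have hL : 1 ≤ Nat.log 2 k := Nat.log_pos (by norm_num) hk
  have hlog : Nat.log 2 (k + 1) ≤ Nat.log 2 k + 1 := by
    have h1 : k + 1 ≤ k * 2 := by omega
    calc Nat.log 2 (k + 1) ≤ Nat.log 2 (k * 2) := Nat.log_mono_right h1
      _ = Nat.log 2 k + 1 := Nat.log_mul_base (by norm_num) (by omega)
  set L := Nat.log 2 k with hLdef
  set L' := Nat.log 2 (k + 1) with hL'def
  refine Nat.pow_lt_pow_right (by norm_num) ?_
  have h1 : (L' + c) ^ c ≤ (L + c + 1) ^ c := Nat.pow_le_pow_left (by omega) c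
  have h2 : 1 ≤ (L + c + 1) ^ c := Nat.one_le_pow c (L + c + 1) (by omega)
  have h3 : L + (c + 1) = L + c + 1 := by omega
  rw [h3, pow_succ]
  calc (L' + c) ^ c ≤ (L + c + 1) ^ c := h1
    _ < (L + c + 1) ^ c * 2 := by omega
    _ ≤ (L + c + 1) ^ c * (L + c + 1) := Nat.mul_le_mul_left _ (by omega)

/-- ★★★ **PENCIL COLLAPSE.**  A valid row family with an infinitesimal exact pencil at the singleton clique `{0}` at every large order has
its located law implied by COR-VIRTUAL: `CorVirtualHardN → F.Law`.  (With the tree's `corVirtualHardN_of_law`: `F.Law ↔ CorVirtualHardN`.) -/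
theorem law_of_corVirtualHardN_of_pencil (F : RowFamily) (k₁ : ℕ) (hP : ∀ k, k₁ ≤ k → Pencil F (k + 1) 0)
    (hV : CorVirtualHardN) : F.Law := by
  classical
  intro c
  obtain ⟨n₀, hn₀⟩ := hV (c + 1)
  refine ⟨n₀ + k₁ + 3, fun n hn K q r hQ m hmq hmax U V hU hV' hfac => ?_⟩
  obtain ⟨k, rfl⟩ : ∃ k, n = k + 1 := ⟨n - 1, by omega⟩
  have hk₀ : n₀ ≤ k := by omega
  have hk₁ : k₁ ≤ k := by omega
  have hk2 : 2 ≤ k := by omega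
  have himg := hasEFOfSize_corFace_of_pencil_blind F (hP k hk₁) q m hmax U V hU hV' hfac
  rw [Fintype.card_option, Fintype.card_fin] at himg
  haveI : Nonempty (top q) := (top_nonempty q).coe_sort
  obtain ⟨K', q', hq'⟩ := LowDim.exists_fin_range_eq (fun j : top q => π (q (j : Fin (K + 1))))
  rw [← hq'] at himg
  have hQ' : HasEFOfSize (convexHull ℝ (Set.range q')) r := by
    rw [hq']
    exact hasEFOfSize_topFace q hQ
  have h1 : T (c + 1) k < r + 1 := hn₀ k hk₀ K' q' (r + 1) himg hQ'.succ
  have h2 : T c (k + 1) < T (c + 1) k := T_succ_lt_T_succ hk2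
  omega

/-- … packaged as an equivalence. -/
theorem law_iff_corVirtualHardN_of_pencil (F : RowFamily) (k₁ : ℕ) (hP : ∀ k, k₁ ≤ k → Pencil F (k + 1) 0) :
    F.Law ↔ CorVirtualHardN :=
  ⟨corVirtualHardN_of_law F, law_of_corVirtualHardN_of_pencil F k₁ hP⟩

/-! ## §7 Instances: L♯(B) and the singleton sub-pencil of `exactTilted` -/

/-- **L♯(B)** (val-idea-41 g4's candidate, `ExactIsVirtual41.md` §3): NONEMPTY clique `a`, tilt `W` with `|W_ij| ≤ B(n)`,
`ρ = udRow a + flat W`, TRULY exact right-hand side `β = h_COR(ρ)`.  Not sharp (no pure tilts; tilt-to-clique ratio `≤ n² B(n)`). -/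
@[reducible] def boundedExact (B : ℕ → ℝ) : RowFamily where
  A := fun n => {p : Finset (Fin n) × Matrix (Fin n) (Fin n) ℝ // p.1.Nonempty ∧ ∀ i j, |p.2 i j| ≤ B n}
  ρ := fun _ a => udRow a.1.1 + flat a.1.2
  β := fun _ a => hCORv (udRow a.1.1 + flat a.1.2)
  valid := fun _ _ => le_hCORv_of_mem _

/-- each entry of a matrix is bounded by the `ℓ¹` norm of its flattening. -/
theorem abs_apply_le_l1_flat {n : ℕ} (W : Matrix (Fin n) (Fin n) ℝ) (i j : Fin n) : |W i j| ≤ l1 (flat W) := by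
  have h := Finset.single_le_sum (f := fun p : Fin (n * n) => |flat W p|) (fun p _ => abs_nonneg _)
    (Finset.mem_univ (finProdFinEquiv (i, j)))
  simpa [flat, l1] using h

/-- L♯(B) has the infinitesimal exact pencil at `{0}` (for every `B > 0`): the rows `({0}, εW)`, `ε ≤ B / (‖W‖₁ + 1)`. -/
theorem boundedExact_pencil (B : ℕ → ℝ) (hB : ∀ n, 0 < B n) (k : ℕ) : Pencil (boundedExact B) (k + 1) 0 := by
  intro W δ hδ
  set S : ℝ := l1 (flat W) with hS
  have hS0 : 0 ≤ S := l1_nonneg _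
  have hε0 : 0 < B (k + 1) / (S + 1) := div_pos (hB _) (by linarith)
  refine ⟨min δ (B (k + 1) / (S + 1)), lt_min hδ hε0, min_le_left _ _, ?_⟩
  set ε : ℝ := min δ (B (k + 1) / (S + 1)) with hεdef
  have hε : 0 < ε := lt_min hδ hε0
  have hεle : ε ≤ B (k + 1) / (S + 1) := min_le_right _ _
  have hent : ∀ i j, |(ε • W) i j| ≤ B (k + 1) := by
    intro i j
    rw [Matrix.smul_apply, smul_eq_mul, abs_mul, abs_of_pos hε]
    have hij : |W i j| ≤ S := abs_apply_le_l1_flat W i j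
    have h3 : B (k + 1) / (S + 1) * S ≤ B (k + 1) := by
      rw [div_mul_eq_mul_div, div_le_iff₀ (by linarith)]
      nlinarith [hB (k + 1)]
    calc ε * |W i j| ≤ ε * S := mul_le_mul_of_nonneg_left hij hε.le
      _ ≤ B (k + 1) / (S + 1) * S := mul_le_mul_of_nonneg_right hεle hS0
      _ ≤ B (k + 1) := h3
  refine ⟨⟨(({0} : Finset (Fin (k + 1))), ε • W), ⟨Finset.singleton_nonempty 0, hent⟩⟩, 1, one_pos, ?_, ?_⟩
  · show udRow {0} + flat (ε • W) = (1 : ℝ) • (udRow {0} + ε • flat W)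
    rw [one_smul]
    rfl
  · show hCORv (udRow {0} + flat (ε • W)) ≤ 1 * hCORv (udRow {0} + ε • flat W)
    rw [one_mul]
    exact le_rfl

/-- ★★★ **g4's candidate L♯(B) IS COR-VIRTUAL**: `(boundedExact B).Law ↔ CorVirtualHardN` for every `B = B(n) > 0`. -/
theorem boundedExactLaw_iff (B : ℕ → ℝ) (hB : ∀ n, 0 < B n) : (boundedExact B).Law ↔ CorVirtualHardN :=
  law_iff_corVirtualHardN_of_pencil _ 0 fun k _ => boundedExact_pencil B hB k

/-- … and hence equivalent to the law of record C′. -/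
theorem boundedExactLaw_iff_exactPencilLaw (B : ℕ → ℝ) (hB : ∀ n, 0 < B n) : (boundedExact B).Law ↔ ExactPencilLaw :=
  (boundedExactLaw_iff B hB).trans exactPencilLaw_iff_corVirtualHardN.symm

/-- **the singleton sub-pencil of `exactTilted`**: rows `({l}, W)` with `|W_ij| ≤ B(n)` and `exactTilted`'s rhs `1 + h_COR(W)`
(exact on the half-cone of tilts whose COR-maximum sits in the face `x_ll = 1`, loose elsewhere). -/
@[reducible] def singletonTilted (B : ℕ → ℝ) : RowFamily where
  A := fun n => {p : Fin n × Matrix (Fin n) (Fin n) ℝ // ∀ i j, |p.2 i j| ≤ B n}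
  ρ := fun _ a => udRow {a.1.1} + flat a.1.2
  β := fun _ a => 1 + hCOR a.1.2
  valid := fun n a => exactTilted.valid n ({a.1.1}, a.1.2)

/-- it embeds in `exactTilted`. -/
def singletonTiltedEmb (B : ℕ → ℝ) : RowFamily.Emb (singletonTilted B) exactTilted where
  φ := fun _ a => ({a.1.1}, a.1.2)
  ρ_eq := fun _ _ => rfl
  β_eq := fun _ _ => rfl

/-- entries of the singleton clique matrix are bounded by `1`. -/
theorem abs_udMat_singleton_le {n : ℕ} (l i j : Fin n) : |udMat {l} i j| ≤ 1 := by
  unfold udMat udInd bvec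
  by_cases hi : i = l
  · by_cases hj : j = l
    · subst hi; subst hj
      norm_num [Finset.mem_singleton]
    · have hlj : l ≠ j := fun h => hj h.symm
      simp [hi, hlj, hj, Finset.mem_singleton]
  · simp [hi, Finset.mem_singleton]

/-- the tilted row of the singleton sub-pencil in closed form: `⟨flat (μ W + ν E₀₀), x_b⟩ = μ ⟨W, x_b⟩ + ν [0 ∈ b]`. -/
theorem flat_tilt_dotProduct_udPt {k : ℕ} (W : Matrix (Fin (k + 1)) (Fin (k + 1)) ℝ) (μ ν : ℝ) (b : Finset (Fin (k + 1))) :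
    flat (μ • W + ν • udMat {0}) ⬝ᵥ udPt b = μ * (flat W ⬝ᵥ udPt b) + ν * (if (0 : Fin (k + 1)) ∈ b then 1 else 0) := by
  rw [LocatedRows.flat_add', LocatedRows.flat_smul', LocatedRows.flat_smul', add_dotProduct, smul_dotProduct, smul_dotProduct, smul_eq_mul, smul_eq_mul]
  change μ * (flat W ⬝ᵥ udPt b) + ν * (udRow {0} ⬝ᵥ udPt b) = _
  rw [udRow_singleton_dotProduct_udPt]

/-- ★ the singleton sub-pencil has the infinitesimal exact pencil at `{0}` (for every `B > 0`): given `W` and small `ε`, the row `({0}, W')`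
with `W' = μ W + ν E₀₀`, `ν = 4 ε ‖W‖₁`, `μ = ε (1 + ν)` is the positive multiple `(1 + ν) · (E₀₀ + ε W)`, its entries are `≤ 6 ε ‖W‖₁ ≤ B`,
and its rhs `1 + h_COR(W')` is EXACT because the lift `ν E₀₀` pushes a COR-maximiser of `W'` into the face `x₀₀ = 1`. -/
theorem singletonTilted_pencil (B : ℕ → ℝ) (hB : ∀ n, 0 < B n) (k : ℕ) : Pencil (singletonTilted B) (k + 1) 0 := by
  intro W δ hδ
  set S : ℝ := l1 (flat W) with hS
  have hS0 : 0 ≤ S := l1_nonneg _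
  have hB' := hB (k + 1)
  have hε00 : 0 < min (1 / (4 * S + 4)) (B (k + 1) / (6 * S + 6)) := lt_min (by positivity) (by positivity)
  refine ⟨min δ (min (1 / (4 * S + 4)) (B (k + 1) / (6 * S + 6))), lt_min hδ hε00, min_le_left _ _, ?_⟩
  set ε : ℝ := min δ (min (1 / (4 * S + 4)) (B (k + 1) / (6 * S + 6))) with hεdef
  have hε : 0 < ε := lt_min hδ hε00
  have hεle : ε ≤ min (1 / (4 * S + 4)) (B (k + 1) / (6 * S + 6)) := min_le_right _ _
  have hε1 : ε ≤ 1 / (4 * S + 4) := hεle.trans (min_le_left _ _)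
  have hε2 : ε ≤ B (k + 1) / (6 * S + 6) := hεle.trans (min_le_right _ _)
  have hεS : 4 * ε * S ≤ 1 := by
    have h := (le_div_iff₀ (by positivity)).1 hε1
    nlinarith
  have hεB : 6 * ε * S + 6 * ε ≤ B (k + 1) := by
    have h := (le_div_iff₀ (by positivity)).1 hε2
    linarith
  set ν : ℝ := 4 * ε * S with hν
  set μ : ℝ := ε * (1 + ν) with hμ
  have hν0 : 0 ≤ ν := by positivity
  have hμ0 : 0 ≤ μ := by positivity
  have hμle : μ ≤ 2 * ε := by rw [hμ]; nlinarith
  -- the bounded entries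
  have hent : ∀ i j : Fin (k + 1), |(μ • W + ν • udMat {0} : Matrix (Fin (k + 1)) (Fin (k + 1)) ℝ) i j| ≤ B (k + 1) := by
    intro i j
    have h1 : |W i j| ≤ S := abs_apply_le_l1_flat W i j
    have h2 : |udMat ({0} : Finset (Fin (k + 1))) i j| ≤ 1 := abs_udMat_singleton_le 0 i j
    have e0 : (μ • W + ν • udMat {0} : Matrix (Fin (k + 1)) (Fin (k + 1)) ℝ) i j
        = μ * W i j + ν * udMat ({0} : Finset (Fin (k + 1))) i j := by
      simp [Matrix.add_apply, Matrix.smul_apply, smul_eq_mul]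
    rw [e0]
    have p1 : μ * |W i j| ≤ 2 * ε * S := mul_le_mul hμle h1 (abs_nonneg _) (by positivity)
    have p2 : ν * |udMat {0} i j| ≤ ν * 1 := mul_le_mul_of_nonneg_left h2 hν0
    calc |μ * W i j + ν * udMat ({0} : Finset (Fin (k + 1))) i j|
        ≤ |μ * W i j| + |ν * udMat ({0} : Finset (Fin (k + 1))) i j| := abs_add_le _ _
      _ = μ * |W i j| + ν * |udMat ({0} : Finset (Fin (k + 1))) i j| := by
          rw [abs_mul μ (W i j), abs_mul ν (udMat ({0} : Finset (Fin (k + 1))) i j), abs_of_nonneg hμ0,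
            abs_of_nonneg hν0]
      _ ≤ B (k + 1) := by linarith
  -- the row is the positive multiple `(1 + ν) • (E₀₀ + ε W)`
  have hρ : udRow {0} + flat (μ • W + ν • udMat {0}) = (1 + ν) • (udRow ({0} : Finset (Fin (k + 1))) + ε • flat W) := by
    have hud : flat (udMat ({0} : Finset (Fin (k + 1)))) = udRow {0} := rfl
    rw [LocatedRows.flat_add', LocatedRows.flat_smul', LocatedRows.flat_smul', hud]
    ext p
    simp only [Pi.add_apply, Pi.smul_apply, smul_eq_mul, hμ]
    ring
  -- exactness of the rhs `1 + h_COR(W')`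
  have hA : 1 + hCOR (μ • W + ν • udMat {0}) ≤ hCORv (udRow {0} + flat (μ • W + ν • udMat {0})) := by
    obtain ⟨b₁, hb₁⟩ := exists_eq_hCOR (μ • W + ν • udMat {0})
    rw [← hb₁]
    by_cases h0 : (0 : Fin (k + 1)) ∈ b₁
    · have h := le_hCORv (udRow {0} + flat (μ • W + ν • udMat {0})) b₁
      rw [add_dotProduct, udRow_singleton_dotProduct_udPt, if_pos h0] at h
      exact h
    · have hle := le_hCORv (udRow {0} + flat (μ • W + ν • udMat {0})) (insert 0 b₁)
      rw [add_dotProduct, udRow_singleton_dotProduct_udPt, if_pos (Finset.mem_insert_self 0 b₁)] at hle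
      have e1 := flat_tilt_dotProduct_udPt W μ ν b₁
      have e2 := flat_tilt_dotProduct_udPt W μ ν (insert 0 b₁)
      rw [if_neg h0] at e1
      rw [if_pos (Finset.mem_insert_self 0 b₁)] at e2
      have f1 := (abs_le.1 (abs_dotProduct_udPt_le (flat W) b₁)).2
      have f2 := (abs_le.1 (abs_dotProduct_udPt_le (flat W) (insert 0 b₁))).1
      have p1 := mul_le_mul_of_nonneg_left f1 hμ0
      have p2 := mul_le_mul_of_nonneg_left f2 hμ0
      have p3 := mul_le_mul_of_nonneg_right hμle hS0
      have e3 : μ * -l1 (flat W) = -(μ * l1 (flat W)) := by ring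
      rw [← hS] at p1 p2 e3
      linarith
  refine ⟨⟨((0 : Fin (k + 1)), μ • W + ν • udMat {0}), hent⟩, 1 + ν, by positivity, hρ, ?_⟩
  show 1 + hCOR (μ • W + ν • udMat {0}) ≤ (1 + ν) * hCORv (udRow {0} + ε • flat W)
  refine hA.trans ?_
  rw [hρ]
  exact hCORv_smul_le (by positivity) _

/-- ★★★ **THE SINGLETON SUB-PENCIL OF `exactTilted` IS COR-VIRTUAL**: `(singletonTilted B).Law ↔ CorVirtualHardN` for every `B = B(n) > 0`. -/
theorem singletonTiltedLaw_iff (B : ℕ → ℝ) (hB : ∀ n, 0 < B n) : (singletonTilted B).Law ↔ CorVirtualHardN :=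
  law_iff_corVirtualHardN_of_pencil _ 0 fun k _ => singletonTilted_pencil B hB k

/-- ★★★ **C′ IS EQUIVALENT TO ITS OWN SINGLETON `B`-BOUNDED SUB-PENCIL**: `ExactPencilLaw ↔ (singletonTilted B).Law` (every `B > 0`).
(`←` is plain monotonicity, `exactPencilLaw_of_singletonTiltedLaw`: a smaller family has the stronger law; `→` — recovering the law of the
tiny sub-family from the law of all of `exactTilted` — goes THROUGH COR-VIRTUAL and is the content of the pencil collapse.) -/
theorem exactPencilLaw_iff_singletonTiltedLaw (B : ℕ → ℝ) (hB : ∀ n, 0 < B n) : ExactPencilLaw ↔ (singletonTilted B).Law :=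
  exactPencilLaw_iff_corVirtualHardN.trans (singletonTiltedLaw_iff B hB).symm

/-- sanity link with the tree's monotonicity: the singleton sub-pencil's law implies `ExactPencilLaw` directly (smaller family, stronger law). -/
theorem exactPencilLaw_of_singletonTiltedLaw (B : ℕ → ℝ) (h : (singletonTilted B).Law) : ExactPencilLaw :=
  RowFamily.Law.mono (singletonTiltedEmb B) h

end Summit.ValiantsHypothesis.ValiantsHypothesis.Theorems.FifoMatching.PencilCollapse
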